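import Literature.Analysis.FluidPDE.HessianLpVector
import Literature.Analysis.FluidPDE.DistributionalPressurePoisson
import Literature.Analysis.FunctionSpaces.LpNormByDuality
import HarnessLib

/-!
# The whole-space Stokes system: the `L^p` estimate for the pressure

Analysis/FluidPDE support file on the decomposition path of the named fact
`Literature.Analysis.FluidPDE.stokes_interior_Lr_estimate` (`FluidPDE/StokesInteriorEstimate`;
T.-P. Tsai, *On Leray's self-similar solutions of the Navier–Stokes equations satisfying local
energy estimates*, Arch. Rational Mech. Anal. 143 (1998), §3.2 display (3.2): the interior
`L^r` estimate for the Stokes system, Galdi, Vol. I (1994) p. 208 = Galdi 2011 Thm IV.4.1 =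
Cattabriga 1961). The interior estimate is obtained (next files) by a cutoff from the
**whole-space a priori estimate** for compactly supported classical pairs `(w, σ)`,
`w ∈ C²_c(ℝ³; ℝ³)`, `σ ∈ C¹_c(ℝ³)`, with body force `F := νΔw - ∇σ` and divergence `g := div w`:
`‖D²w‖_p + ‖∇σ‖_p ≤ C (‖F‖_p + ‖∇g‖_p)`, `1 < p < ∞` (Cattabriga 1961; Galdi 2011, Ch. IV §IV.2).
This file proves its **pressure half**, from the single Calderón–Zygmund primitive of the tree,
the named fact `stein1970_hessian_Lp_bound` (Stein 1970, Ch. III §1.3 Prop. 3,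
`FluidPDE/HessianLaplacianLp`):

* `integral_pressure_mul_laplacian_eq` — the **weak pressure equation**: for every `χ ∈ C³`,
  `∫ (σ - ν div w) Δχ = ∫ ⟪νΔw - ∇σ, ∇χ⟫`, i.e. `Δ(σ - ν g) = -div F` in the sense of
  distributions (two Green identities and `∫ ⟪w, ∇Δχ⟫ = -∫ (div w) Δχ`; no boundary terms).
* `stokes_pressure_Lp_estimate` — **the pressure estimate**: given
  `stein1970_hessian_Lp_bound ℝ³`, for `1 < p < ∞` there is `C = C(p)` with
  `‖∂ₐ(σ - ν div w)‖_{L^p(ℝ³)} ≤ C ‖νΔw - ∇σ‖_{L^p(ℝ³)}` for all such pairs, all `ν ∈ ℝ` and all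
  `‖a‖ ≤ 1`; this is the `L^p` boundedness of `∇Δ⁻¹div` ("`-Σᵢ RₐRᵢ`") in a priori form.

## The argument for the pressure estimate

By the norming lemma (`FunctionSpaces/LpNormByDuality`: `‖f‖_p ≤ B` as soon as
`|∫ f φ| ≤ B ‖φ‖_{p'}` for all `φ ∈ C^∞_c`) applied to `f = ∂ₐσ'`, `σ' = σ - ν div w`, it
suffices to bound the pairing with a test function `φ`. Realise `Δ⁻¹` at a scale `r` by the
truncated Newtonian potential of the tree (`FluidPDE/NewtonLocalPotential`): `U = N_{r/2,r}[φ]`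
is smooth with compact support and `ΔU = φ - Λ_r[φ]`, `Λ_r[φ] = λ_{r/2,r} * φ`. Then
`∫ f φ = ∫ ∂ₐσ' ΔU + ∫ ∂ₐσ' Λ_r[φ]`, and

* `∫ ∂ₐσ' ΔU = -∫ σ' Δ(∂ₐU) = -∫ ⟪F, ∇∂ₐU⟫` (integration by parts, the weak equation with
  `χ = ∂ₐU`), bounded by `‖F‖_p ‖∇∂ₐU‖_{p'} ≤ ‖F‖_p Σᵢ ‖∂ᵢ∂ₐU‖_{p'} ≤ 3 C_N ‖F‖_p ‖φ‖_{p'}` by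
  Hölder and the scale-uniform `L^{p'}` bound for the Hessian of the truncated potential
  (`stein1970_hessian_Lp_bound.hessian_newtonNearPotential_half`, from Stein's Prop. 3 at the
  dual exponent);
* `|∫ ∂ₐσ' Λ_r[φ]| ≤ ‖∂ₐσ'‖_1 sup|Λ_r[φ]| ≤ ‖∂ₐσ'‖_1 ‖φ‖_1 sup|λ_{r/2,r}| = O(r⁻³)` by the
  scaling `λ_{r/2,r}(z) = r⁻³λ_{1/2,1}(z/r)`; letting `r → ∞` this lower-order term disappears,

so `|∫ f φ| ≤ 3 C_N ‖F‖_p ‖φ‖_{p'}` and `‖∂ₐσ'‖_p ≤ 3 C_N ‖F‖_p`.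

## Mathlib / tree search

No Stokes / Cattabriga / Calderón–Zygmund estimates in Mathlib or the tree (`lean search`
`Cattabriga|stokes.*estimate|Calderon`: only the named facts `stokes_interior_Lr_estimate`,
`stein1970_hessian_Lp_bound`, `stein1970_normalisedPressure_Lp_bound`). Tree, all used:
`newtonNearPotential`, `newtonFarSmoothing`, `laplacian_newtonNearPotential`,
`contDiff_newtonNearPotential`, `hasCompactSupport_newtonNearPotential` (`NewtonLocalPotential`);
`newtonFarLaplacian_scale`, `continuous_`/`hasCompactSupport_newtonFarLaplacian`
(`NewtonPotential`, `NewtonKernel`); `stein1970_hessian_Lp_bound.hessian_newtonNearPotential_half`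
(`HessianLaplacianLp`); `integral_mul_divergence_add_eq_zero_left/right`,
`integral_mul_fderiv_apply_eq_neg` (`WholeSpaceIBP`, `HessianLaplacian`);
`integral_inner_laplacian_comm` (`ClassicalSolutionCalculus`); `divergence_gradient`
(`PressurePoisson`); `laplacian_gradient` (`DistributionalPressurePoisson`);
`fderiv_laplacian_apply` (`HelmholtzAnnihilator`); `contDiff_divergence`
(`TaoEnstrophyLocalisationProofs`); `eLpNorm_le_of_forall_enorm_integral_mul_le`
(`FunctionSpaces/LpNormByDuality`).

## References

* G. P. Galdi, *An introduction to the mathematical theory of the Navier–Stokes equations*,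
  2nd ed., Springer (2011), Ch. IV §IV.2 (whole space) and §IV.4, Thm IV.4.1 (interior; the
  reference "[Ga I p. 208]" of Tsai) [Galdi2011] — not held (WANTED doi:10.1007/978-0-387-09620-9);
  L. Cattabriga, Rend. Sem. Mat. Univ. Padova 31 (1961) 308–340.
* E. M. Stein, *Singular integrals and differentiability properties of functions* (1970),
  Ch. III §1.3 Prop. 3 [Stein1971].
* T.-P. Tsai, Arch. Rational Mech. Anal. 143 (1998) 29–51, §3.2 (3.2) p. 37 [Tsai1998].
-/

noncomputable section

open MeasureTheory Set Filter Function Metric InnerProductSpace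
open scoped ENNReal NNReal RealInnerProductSpace Laplacian ContDiff

namespace Literature.Analysis.FluidPDE

/-! ### The weak pressure equation `Δ(σ - ν div w) = -div(νΔw - ∇σ)` -/

section WeakEquation

variable {E : Type*} [NormedAddCommGroup E] [InnerProductSpace ℝ E] [FiniteDimensional ℝ E]
  [MeasurableSpace E] [BorelSpace E]

/-- **`∫ σ Δχ = -∫ ⟪∇σ, ∇χ⟫`** for `σ ∈ C¹_c`, `χ ∈ C²` (Green's first identity without
boundary, through `div ∇χ = Δχ`). [folklore] -/
theorem integral_mul_laplacian_eq_neg_integral_inner_gradient {σ χ : E → ℝ}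
    (hσ : ContDiff ℝ 1 σ) (hσc : HasCompactSupport σ) (hχ : ContDiff ℝ 2 χ) :
    ∫ x, σ x * (Δ χ) x = -∫ x, ⟪gradient σ x, gradient χ x⟫ := by
  have hgradχ : ContDiff ℝ 1 (gradient χ) :=
    (InnerProductSpace.toDual ℝ E).symm.contDiff.comp (hχ.fderiv_right (m := 1) le_rfl)
  have h := integral_mul_divergence_add_eq_zero_left hσ hgradχ hσc
  have e1 : (fun x => σ x * VectorCalculus.divergence (gradient χ) x) = fun x => σ x * (Δ χ) x :=
    funext fun x => by rw [divergence_gradient hχ x]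
  have e2 : ∫ x, ⟪gradient χ x, gradient σ x⟫ = ∫ x, ⟪gradient σ x, gradient χ x⟫ :=
    integral_congr_ae (Eventually.of_forall fun x => real_inner_comm _ _)
  rw [e1, e2] at h
  linarith

/-- **`∫ ⟪Δw, ∇χ⟫ = -∫ (div w) Δχ`** for `w ∈ C²_c(E; E)`, `χ ∈ C³` (symmetry of `Δ`,
`Δ∇χ = ∇Δχ`, and `∫ ⟪w, ∇θ⟫ = -∫ θ div w`). [folklore] -/
theorem integral_inner_laplacian_gradient_eq {w : E → E} {χ : E → ℝ} (hw : ContDiff ℝ 2 w)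
    (hwc : HasCompactSupport w) (hχ : ContDiff ℝ 3 χ) :
    ∫ x, ⟪(Δ w) x, gradient χ x⟫ = -∫ x, VectorCalculus.divergence w x * (Δ χ) x := by
  have hgradχ : ContDiff ℝ 2 (gradient χ) :=
    (InnerProductSpace.toDual ℝ E).symm.contDiff.comp (hχ.fderiv_right (m := 2) le_rfl)
  have hΔχ : ContDiff ℝ 1 (Δ χ) := contDiff_laplacian (n := 1) (by exact_mod_cast hχ)
  have h1 : ∫ x, ⟪(Δ w) x, gradient χ x⟫ = ∫ x, ⟪w x, gradient (Δ χ) x⟫ := by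
    have h := integral_inner_laplacian_comm hgradχ hw hwc
    calc ∫ x, ⟪(Δ w) x, gradient χ x⟫ = ∫ x, ⟪gradient χ x, (Δ w) x⟫ :=
          integral_congr_ae (Eventually.of_forall fun x => real_inner_comm _ _)
      _ = ∫ x, ⟪(Δ (gradient χ)) x, w x⟫ := h.symm
      _ = ∫ x, ⟪w x, gradient (Δ χ) x⟫ :=
          integral_congr_ae (Eventually.of_forall fun x => by
            dsimp only
            rw [laplacian_gradient hχ x, real_inner_comm])
  rw [h1]
  have h2 := integral_mul_divergence_add_eq_zero_right hΔχ (hw.of_le (by norm_num)) hwc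
  have e : ∫ x, (Δ χ) x * VectorCalculus.divergence w x =
      ∫ x, VectorCalculus.divergence w x * (Δ χ) x :=
    integral_congr_ae (Eventually.of_forall fun x => mul_comm _ _)
  linarith

omit [FiniteDimensional ℝ E] [MeasurableSpace E] [BorelSpace E] in
/-- The divergence of a compactly supported field has compact support. [folklore] -/
theorem hasCompactSupport_divergence {w : E → E} (hwc : HasCompactSupport w) :
    HasCompactSupport (VectorCalculus.divergence w) :=
  hwc.mono' fun x hx => by
    contrapose! hx
    simp only [mem_support, not_not]
    exact divergence_eq_zero_of_notMem_tsupport hx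

/-- **The weak pressure equation of the whole-space Stokes system.** For `w ∈ C²_c(E; E)`,
`σ ∈ C¹_c(E)`, `ν ∈ ℝ` and every `χ ∈ C³(E)`,
`∫ (σ - ν div w) Δχ = ∫ ⟪νΔw - ∇σ, ∇χ⟫`:
with `F := νΔw - ∇σ` and `g := div w`, the modified pressure `σ' = σ - νg` solves
`Δσ' = -div F` in the sense of distributions (apply `div` to the Stokes system; Galdi 2011,
Ch. IV §IV.2). [folklore] -/
theorem integral_pressure_mul_laplacian_eq {w : E → E} {σ : E → ℝ} (hw : ContDiff ℝ 2 w)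
    (hwc : HasCompactSupport w) (hσ : ContDiff ℝ 1 σ) (hσc : HasCompactSupport σ) (ν : ℝ)
    {χ : E → ℝ} (hχ : ContDiff ℝ 3 χ) :
    ∫ x, (σ x - ν * VectorCalculus.divergence w x) * (Δ χ) x =
      ∫ x, ⟪ν • (Δ w) x - gradient σ x, gradient χ x⟫ := by
  have hχ2 : ContDiff ℝ 2 χ := hχ.of_le (by norm_num)
  have hΔχ : Continuous (Δ χ) := continuous_laplacian hχ2
  have hgχ : Continuous (gradient χ) := continuous_gradient_of_contDiff (hχ2.of_le one_le_two)
  have hdiv : Continuous (VectorCalculus.divergence w) :=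
    continuous_divergence (hw.continuous_fderiv two_ne_zero)
  -- integrability of the four pieces (compact support from `σ`, `w`)
  have hi1 : Integrable (fun x => σ x * (Δ χ) x) :=
    (hσ.continuous.mul hΔχ).integrable_of_hasCompactSupport hσc.mul_right
  have hi2 : Integrable (fun x => VectorCalculus.divergence w x * (Δ χ) x) :=
    (hdiv.mul hΔχ).integrable_of_hasCompactSupport (hasCompactSupport_divergence hwc).mul_right
  have hi3 : Integrable (fun x => ⟪(Δ w) x, gradient χ x⟫) := by
    refine ((continuous_laplacian hw).inner hgχ).integrable_of_hasCompactSupport ?_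
    refine hwc.mono' fun x hx => ?_
    contrapose! hx
    simp only [mem_support, not_not]
    rw [laplacian_eq_zero_of_notMem_tsupport hx, inner_zero_left]
  have hi4 : Integrable (fun x => ⟪gradient σ x, gradient χ x⟫) := by
    refine ((continuous_gradient_of_contDiff hσ).inner hgχ).integrable_of_hasCompactSupport ?_
    refine hσc.mono' fun x hx => ?_
    contrapose! hx
    simp only [mem_support, not_not]
    rw [gradient_eq_zero_of_notMem_tsupport hx, inner_zero_left]
  -- expand both sides
  have lhs : ∫ x, (σ x - ν * VectorCalculus.divergence w x) * (Δ χ) x =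
      (∫ x, σ x * (Δ χ) x) - ν * ∫ x, VectorCalculus.divergence w x * (Δ χ) x := by
    rw [← integral_const_mul, ← integral_sub hi1 (hi2.const_mul ν)]
    refine integral_congr_ae (Eventually.of_forall fun x => ?_)
    ring
  have rhs : ∫ x, ⟪ν • (Δ w) x - gradient σ x, gradient χ x⟫ =
      ν * (∫ x, ⟪(Δ w) x, gradient χ x⟫) - ∫ x, ⟪gradient σ x, gradient χ x⟫ := by
    rw [← integral_const_mul, ← integral_sub (hi3.const_mul ν) hi4]
    refine integral_congr_ae (Eventually.of_forall fun x => ?_)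
    dsimp only
    rw [inner_sub_left, real_inner_smul_left]
  rw [lhs, rhs, integral_mul_laplacian_eq_neg_integral_inner_gradient hσ hσc hχ2,
    integral_inner_laplacian_gradient_eq hw hwc hχ]
  ring

end WeakEquation

/-! ### The `L^p` estimate for the pressure on `ℝ³` -/

section Pressure

/-- **The regularised Laplacian kernel is `O(r⁻³)` in sup norm at scale `r`:** there is `S ≥ 0`
with `|λ_{r/2,r}(z)| ≤ S / r³` for all `r > 0` and `z` (scaling
`λ_{r/2,r}(z) = r⁻³ λ_{1/2,1}(z/r)` and boundedness of the smooth compactly supported `λ_{1/2,1}`).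
[folklore] -/
theorem exists_forall_abs_newtonFarLaplacian_half_le :
    ∃ S : ℝ, 0 ≤ S ∧ ∀ ⦃r : ℝ⦄, 0 < r → ∀ z : EuclideanSpace ℝ (Fin 3),
      |newtonFarLaplacian (r / 2) r z| ≤ S / r ^ 3 := by
  have h₀ : (0 : ℝ) < 1 / 2 := by norm_num
  have h₁ : (1 / 2 : ℝ) < 1 := by norm_num
  obtain ⟨S, hS⟩ := (continuous_newtonFarLaplacian h₀ h₁).bounded_above_of_compact_support
    (hasCompactSupport_newtonFarLaplacian h₀.le h₁)
  refine ⟨max S 0, le_max_right _ _, fun r hr z => ?_⟩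
  have e : newtonFarLaplacian (r / 2) r z =
      r⁻¹ ^ 3 * newtonFarLaplacian (1 / 2) 1 (r⁻¹ • z) := by
    have := newtonFarLaplacian_scale hr (1 / 2) 1 z
    rw [mul_one, show r * (1 / 2) = r / 2 by ring] at this
    exact this
  have hb : |newtonFarLaplacian (1 / 2) 1 (r⁻¹ • z)| ≤ max S 0 :=
    (Real.norm_eq_abs _ ▸ hS (r⁻¹ • z)).trans (le_max_left _ _)
  rw [e, abs_mul, abs_of_pos (by positivity : (0 : ℝ) < r⁻¹ ^ 3), inv_pow, ← div_eq_inv_mul]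
  exact div_le_div_of_nonneg_right hb (by positivity)

/-- **Sup bound for the smoothing remainder at scale `r`:** `|Λ_{r/2,r}[φ](x)| ≤ (S/r³) ∫|φ|`
for integrable `φ`, with `S` as in `exists_forall_abs_newtonFarLaplacian_half_le`. [folklore] -/
theorem abs_newtonFarSmoothing_half_le {S : ℝ}
    (hS : ∀ ⦃r : ℝ⦄, 0 < r → ∀ z : EuclideanSpace ℝ (Fin 3),
      |newtonFarLaplacian (r / 2) r z| ≤ S / r ^ 3)
    {r : ℝ} (hr : 0 < r) {φ : EuclideanSpace ℝ (Fin 3) → ℝ} (hφ : Integrable φ)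
    (x : EuclideanSpace ℝ (Fin 3)) :
    |newtonFarSmoothing (r / 2) r φ x| ≤ S / r ^ 3 * ∫ z, |φ z| := by
  rw [newtonFarSmoothing_apply]
  have hint : Integrable fun z : EuclideanSpace ℝ (Fin 3) => S / r ^ 3 * |φ (x - z)| :=
    ((hφ.comp_sub_left x).abs.const_mul _)
  calc |∫ z, newtonFarLaplacian (r / 2) r z * φ (x - z)|
      ≤ ∫ z, |newtonFarLaplacian (r / 2) r z * φ (x - z)| := abs_integral_le_integral_abs
    _ ≤ ∫ z, S / r ^ 3 * |φ (x - z)| := by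
        refine integral_mono_of_nonneg (Eventually.of_forall fun z => abs_nonneg _) hint
          (Eventually.of_forall fun z => ?_)
        dsimp only
        rw [abs_mul]
        exact mul_le_mul_of_nonneg_right (hS hr z) (abs_nonneg _)
    _ = S / r ^ 3 * ∫ z, |φ z| := by
        rw [integral_const_mul, integral_sub_left_eq_self (fun z => |φ z|) volume x]

/-- In an orthonormal frame the `L^q` norm of a gradient is at most the sum of the `L^q` norms of
the partial derivatives: `‖∇χ‖_q ≤ Σᵢ ‖∂ᵢχ‖_q` (from `‖v‖ ≤ Σᵢ |⟨bᵢ, v⟩|`). [folklore] -/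
theorem eLpNorm_gradient_le_sum {ι : Type*} [Fintype ι]
    (b : OrthonormalBasis ι ℝ (EuclideanSpace ℝ (Fin 3))) {χ : EuclideanSpace ℝ (Fin 3) → ℝ}
    (hχ : ContDiff ℝ 1 χ) (q : ℝ≥0∞) (hq : 1 ≤ q) :
    eLpNorm (gradient χ) q volume ≤
      ∑ i, eLpNorm (fun x => fderiv ℝ χ x (b i)) q volume := by
  have hmeas : ∀ i, AEStronglyMeasurable (fun x => |fderiv ℝ χ x (b i)|) volume := fun i =>
    ((hχ.continuous_fderiv one_ne_zero).clm_apply continuous_const).abs.aestronglyMeasurable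
  have hpt : ∀ x, ‖gradient χ x‖ ≤ ∑ i, |fderiv ℝ χ x (b i)| := fun x => by
    refine (norm_le_sum_abs_inner b (gradient χ x)).trans (le_of_eq ?_)
    exact Finset.sum_congr rfl fun i _ => by rw [inner_gradient_eq_fderiv_apply]
  have hfun : (fun x => ∑ i, |fderiv ℝ χ x (b i)|) = ∑ i, fun x => |fderiv ℝ χ x (b i)| := by
    funext x
    simp only [Finset.sum_apply]
  calc eLpNorm (gradient χ) q volume
      ≤ eLpNorm (fun x => ∑ i, |fderiv ℝ χ x (b i)|) q volume := eLpNorm_mono_real hpt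
    _ = eLpNorm (∑ i, fun x => |fderiv ℝ χ x (b i)|) q volume := by rw [hfun]
    _ ≤ ∑ i, eLpNorm (fun x => |fderiv ℝ χ x (b i)|) q volume := eLpNorm_sum_le (fun i _ => hmeas i) hq
    _ = ∑ i, eLpNorm (fun x => fderiv ℝ χ x (b i)) q volume :=
        Finset.sum_congr rfl fun i _ => eLpNorm_norm (fun x => fderiv ℝ χ x (b i))

/-- **The `L^p` pressure estimate for the whole-space Stokes system** (a priori, compactly
supported classical pairs; Cattabriga 1961, Galdi 2011 Ch. IV §IV.2 — the pressure part, i.e. the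
`L^p` boundedness of `∇Δ⁻¹div`), *given Stein's Proposition 3*: for `1 < p < ∞` there is `C = C(p)` such that for
every `ν ∈ ℝ`, every `w ∈ C²_c(ℝ³; ℝ³)`, every `σ ∈ C¹_c(ℝ³)` and every direction `‖a‖ ≤ 1`,
`‖∂ₐ(σ - ν div w)‖_{L^p(ℝ³)} ≤ C ‖νΔw - ∇σ‖_{L^p(ℝ³)}`.
Proof: the norming lemma, the weak pressure equation tested with `χ = ∂ₐN_{r/2,r}[φ]`, Hölder,
the scale-uniform Hessian bound for the truncated Newtonian potential at the dual exponent, and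
`r → ∞` for the smoothing remainder (module docstring). PROVED here from the named fact
`stein1970_hessian_Lp_bound`. [cite: Stein1971, Ch. III §1.3 Prop 3] -/
theorem stokes_pressure_Lp_estimate (h : stein1970_hessian_Lp_bound (EuclideanSpace ℝ (Fin 3)))
    {p : ℝ≥0∞} (hp : 1 < p) (hp' : p < ⊤) :
    ∃ C : ℝ≥0, ∀ (ν : ℝ) (w : EuclideanSpace ℝ (Fin 3) → EuclideanSpace ℝ (Fin 3))
      (σ : EuclideanSpace ℝ (Fin 3) → ℝ), ContDiff ℝ 2 w → HasCompactSupport w →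
      ContDiff ℝ 1 σ → HasCompactSupport σ → ∀ a : EuclideanSpace ℝ (Fin 3), ‖a‖ ≤ 1 →
        eLpNorm (fun x => fderiv ℝ (fun y => σ y - ν * VectorCalculus.divergence w y) x a)
            p volume ≤
          C * eLpNorm (fun x => ν • (Δ w) x - gradient σ x) p volume := by
  -- the dual exponent `q = p'`
  set q : ℝ≥0∞ := ENNReal.conjExponent p with hq_def
  haveI hpq : p.HolderConjugate q := ENNReal.HolderConjugate.conjExponent hp.le
  have hq : 1 < q := (ENNReal.HolderConjugate.lt_top_iff_one_lt (p := p) (q := q)).1 hp'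
  have hq' : q < ⊤ := (ENNReal.HolderConjugate.lt_top_iff_one_lt (p := q) (q := p)).2 hp
  -- Stein's Proposition 3 at the dual exponent, for the truncated Newtonian potential
  obtain ⟨CN, hCN⟩ := h.hessian_newtonNearPotential_half hq hq'
  obtain ⟨S, hS0, hS⟩ := exists_forall_abs_newtonFarLaplacian_half_le
  set eb := EuclideanSpace.basisFun (Fin 3) ℝ with heb
  refine ⟨3 * CN, fun ν w σ hw hwc hσ hσc a ha => ?_⟩
  -- the modified pressure `σ' = σ - ν div w`, the force `F = νΔw - ∇σ`, and `f = ∂ₐσ'`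
  set σ' : EuclideanSpace ℝ (Fin 3) → ℝ := fun y => σ y - ν * VectorCalculus.divergence w y
    with hσ'
  set F : EuclideanSpace ℝ (Fin 3) → EuclideanSpace ℝ (Fin 3) :=
    fun x => ν • (Δ w) x - gradient σ x with hF
  have hdiv1 : ContDiff ℝ 1 (VectorCalculus.divergence w) :=
    contDiff_divergence (n := 1) (by exact_mod_cast hw)
  have hσ'1 : ContDiff ℝ 1 σ' := hσ.sub (contDiff_const.mul hdiv1)
  have hσ'c : HasCompactSupport σ' :=
    hσc.sub (hasCompactSupport_divergence hwc).mul_left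
  set f : EuclideanSpace ℝ (Fin 3) → ℝ := fun x => fderiv ℝ σ' x a with hf
  have hfc : Continuous f := (hσ'1.continuous_fderiv one_ne_zero).clm_apply continuous_const
  have hfcs : HasCompactSupport f := hσ'c.fderiv_apply ℝ a
  have hf_memLp : MemLp f p volume := hfc.memLp_of_hasCompactSupport hfcs
  have hfi : Integrable f := hfc.integrable_of_hasCompactSupport hfcs
  have hFc : Continuous F :=
    ((continuous_laplacian hw).const_smul ν).sub (continuous_gradient_of_contDiff hσ)
  have hFm : AEStronglyMeasurable F volume := hFc.aestronglyMeasurable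
  -- the norming lemma: test `f` against `φ ∈ C^∞_c`
  refine FunctionSpaces.eLpNorm_le_of_forall_enorm_integral_mul_le (q := q) hp hp'.ne hf_memLp
    fun φ hφ hφc => ?_
  refine ENNReal.le_of_forall_pos_le_add fun ε hε _ => ?_
  have hε' : (0 : ℝ) < ε := by exact_mod_cast hε
  have hφ2 : ContDiff ℝ 2 φ := by
    have := contDiff_infty.1 hφ 2
    exact_mod_cast this
  have hφi : Integrable φ := hφ.continuous.integrable_of_hasCompactSupport hφc
  have hφm : AEStronglyMeasurable φ volume := hφ.continuous.aestronglyMeasurable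
  -- the size of the remainder and the choice of the scale `r`
  set K : ℝ := (∫ x, |f x|) * (S * ∫ z, |φ z|) with hK
  have hK0 : 0 ≤ K := by positivity
  set r : ℝ := max 1 (K / ε) with hr
  have hr1 : 1 ≤ r := le_max_left _ _
  have hr0 : 0 < r := one_pos.trans_le hr1
  have hKr : K / r ^ 3 ≤ ε := by
    have h1 : K / r ^ 3 ≤ K / r :=
      div_le_div_of_nonneg_left hK0 hr0 (le_self_pow₀ hr1 (by norm_num))
    have h2 : K / r ≤ ε := by
      rw [div_le_iff₀ hr0]
      have : K / ε ≤ r := le_max_right _ _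
      rw [div_le_iff₀ hε'] at this
      linarith
    exact h1.trans h2
  -- the truncated Newtonian potential `U = N_{r/2,r}[φ]` and the remainder `Λφ`
  have h₀ : 0 < r / 2 := by positivity
  have h₁ : r / 2 < r := by linarith
  set U : EuclideanSpace ℝ (Fin 3) → ℝ := newtonNearPotential (r / 2) r φ with hU
  set Λφ : EuclideanSpace ℝ (Fin 3) → ℝ := newtonFarSmoothing (r / 2) r φ with hΛφ
  have hU4 : ContDiff ℝ 4 (U) := by
    have := contDiff_newtonNearPotential h₀.le h₁ 4 (contDiff_infty.1 hφ 4)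
    exact_mod_cast this
  have hU3 : ContDiff ℝ 3 U := hU4.of_le (by norm_num)
  have hΔU1 : ContDiff ℝ 1 (Δ U) := contDiff_laplacian (n := 1) (by exact_mod_cast hU3)
  have hΔU : ∀ x, (Δ U) x = φ x - Λφ x := fun x => laplacian_newtonNearPotential h₀ h₁ hφ2 x
  have hΛc : Continuous Λφ := continuous_newtonFarSmoothing h₀ h₁ hφ.continuous
  -- the test direction `χ = ∂ₐU ∈ C³`
  set χ : EuclideanSpace ℝ (Fin 3) → ℝ := fun y => fderiv ℝ U y a with hχ_def
  have hχ : ContDiff ℝ 3 χ := (hU4.fderiv_right (m := 3) (by norm_num)).clm_apply contDiff_const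
  have hχ1 : ContDiff ℝ 1 χ := hχ.of_le (by norm_num)
  have hgχm : AEStronglyMeasurable (gradient χ) volume :=
    (continuous_gradient_of_contDiff hχ1).aestronglyMeasurable
  -- splitting of the pairing: `∫ f φ = ∫ f ΔU + ∫ f Λφ`
  have hI1 : Integrable (fun x => f x * (Δ U) x) :=
    (hfc.mul hΔU1.continuous).integrable_of_hasCompactSupport hfcs.mul_right
  have hI2 : Integrable (fun x => f x * Λφ x) :=
    (hfc.mul hΛc).integrable_of_hasCompactSupport hfcs.mul_right
  have hsplit : ∫ x, f x * φ x = (∫ x, f x * (Δ U) x) + ∫ x, f x * Λφ x := by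
    rw [← integral_add hI1 hI2]
    refine integral_congr_ae (Eventually.of_forall fun x => ?_)
    dsimp only
    rw [hΔU x]
    ring
  -- (i) the main term: `∫ f ΔU = -∫ ⟪F, ∇χ⟫`
  have e1 : ∫ x, f x * (Δ U) x = -∫ x, ⟪F x, gradient χ x⟫ := by
    have hibp := integral_mul_fderiv_apply_eq_neg hΔU1 hσ'1 hσ'c a
    have e2 : ∫ x, σ' x * (Δ χ) x = ∫ x, ⟪F x, gradient χ x⟫ :=
      integral_pressure_mul_laplacian_eq hw hwc hσ hσc ν hχ
    calc ∫ x, f x * (Δ U) x = ∫ x, (Δ U) x * fderiv ℝ σ' x a :=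
          integral_congr_ae (Eventually.of_forall fun x => mul_comm _ _)
      _ = -∫ x, fderiv ℝ (Δ U) x a * σ' x := hibp
      _ = -∫ x, σ' x * (Δ χ) x := by
          congr 1
          refine integral_congr_ae (Eventually.of_forall fun x => ?_)
          dsimp only
          rw [fderiv_laplacian_apply hU3 x a, mul_comm]
      _ = -∫ x, ⟪F x, gradient χ x⟫ := by rw [e2]
  have hgradχ : eLpNorm (gradient χ) q volume ≤ ↑(3 * CN) * eLpNorm φ q volume := by
    refine (eLpNorm_gradient_le_sum eb hχ1 q hq.le).trans ?_
    calc ∑ i, eLpNorm (fun x => fderiv ℝ χ x (eb i)) q volume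
        ≤ ∑ _i : Fin 3, (CN : ℝ≥0∞) * eLpNorm φ q volume :=
          Finset.sum_le_sum fun i _ => hCN hr0 hφ2 hφc a (eb i) ha (eb.orthonormal.1 i).le
      _ = ↑(3 * CN) * eLpNorm φ q volume := by
          simp only [Finset.sum_const, Finset.card_univ, Fintype.card_fin, nsmul_eq_mul]
          push_cast
          ring
  have hmain : ‖∫ x, f x * (Δ U) x‖ₑ ≤
      ↑(3 * CN) * eLpNorm F p volume * eLpNorm φ q volume := by
    rw [e1, enorm_neg]
    calc ‖∫ x, ⟪F x, gradient χ x⟫‖ₑ ≤ ∫⁻ x, ‖⟪F x, gradient χ x⟫‖ₑ :=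
          enorm_integral_le_lintegral_enorm _
      _ = eLpNorm (fun x => ⟪F x, gradient χ x⟫) 1 volume := by
          rw [eLpNorm_one_eq_lintegral_enorm]
      _ ≤ (1 : ℝ≥0) * eLpNorm F p volume * eLpNorm (gradient χ) q volume :=
          eLpNorm_le_eLpNorm_mul_eLpNorm_of_nnnorm hFm hgχm (fun u v => ⟪u, v⟫) 1
            (Eventually.of_forall fun x => by
              rw [one_mul]
              exact nnnorm_inner_le_nnnorm (𝕜 := ℝ) _ _)
      _ ≤ (1 : ℝ≥0) * eLpNorm F p volume * (↑(3 * CN) * eLpNorm φ q volume) := by gcongr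
      _ = ↑(3 * CN) * eLpNorm F p volume * eLpNorm φ q volume := by
          simp only [ENNReal.coe_one, one_mul]
          ring
  -- (ii) the remainder: `|∫ f Λφ| ≤ K / r³ ≤ ε`
  have hrem : ‖∫ x, f x * Λφ x‖ₑ ≤ ε := by
    have hb : |∫ x, f x * Λφ x| ≤ K / r ^ 3 := by
      have hint : Integrable fun x => |f x| * (S / r ^ 3 * ∫ z, |φ z|) := hfi.abs.mul_const _
      calc |∫ x, f x * Λφ x| ≤ ∫ x, |f x * Λφ x| := abs_integral_le_integral_abs
        _ ≤ ∫ x, |f x| * (S / r ^ 3 * ∫ z, |φ z|) := by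
            refine integral_mono_of_nonneg (Eventually.of_forall fun x => abs_nonneg _) hint
              (Eventually.of_forall fun x => ?_)
            dsimp only
            rw [abs_mul]
            exact mul_le_mul_of_nonneg_left (abs_newtonFarSmoothing_half_le hS hr0 hφi x)
              (abs_nonneg _)
        _ = (∫ x, |f x|) * (S / r ^ 3 * ∫ z, |φ z|) := integral_mul_const _ _
        _ = K / r ^ 3 := by rw [hK]; ring
    rw [Real.enorm_eq_ofReal_abs, ← ENNReal.ofReal_coe_nnreal]
    exact ENNReal.ofReal_le_ofReal (hb.trans hKr)
  -- conclusion
  calc ‖∫ x, f x * φ x‖ₑ = ‖(∫ x, f x * (Δ U) x) + ∫ x, f x * Λφ x‖ₑ := by rw [hsplit]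
    _ ≤ ‖∫ x, f x * (Δ U) x‖ₑ + ‖∫ x, f x * Λφ x‖ₑ := enorm_add_le _ _
    _ ≤ ↑(3 * CN) * eLpNorm F p volume * eLpNorm φ q volume + ε := add_le_add hmain hrem

end Pressure

end Literature.Analysis.FluidPDE

end
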